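import Literature.NumberTheory.EllipticCurves.IwasawaAlgebraGenericSpecializationRankProofs
import Mathlib.RingTheory.UniqueFactorizationDomain.Multiplicity
import HarnessLib

/-!
# Crux 4 `BSDpOnCellC` (stmt-BirchSwinnertonDyer-19034), line `telescope`, leaves N2′/N3′ — road (a′) of the `S₀`-residual, ALGEBRA HALF:
# an element of a finitely generated `Λ = ℤ_p⟦X⟧`-module that is `(X − x_k)`-divisible up to finite order for infinitely many `x_k ∈ 𝔪`
# is TORSION; and `(T/J)[θ]` is finite for `J ⊆ T_{Λ-tors}` when `T[θ] = 0`
# (helper, `--supports stmt-BirchSwinnertonDyer-19034 --as helper`; closes nothing; pure commutative algebra)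

Cell `bsd-eis`, width seat `bsd-line-x2-p2` (prover g21, 2026-08-30; D-0154 KEY row 5). THEOREMS ONLY: no definition, no named fact,
no `sorry`, no instance, no notation. The two generic lemmas behind the seat's memo `ROAD-A-PRICING-x2p2g21.md` §3 (evidence #46 on
-19034), stated over the tree's `IwasawaAlgebra p = PowerSeries ℤ_[p]` in the vocabulary of the generic-specialisation engine
(`IwasawaAlgebraGenericTwistFiniteProofs`: `θ_c = X − C c`, `c ∈ 𝔪_{ℤ_p}`, is prime, `θ_c ∣ C a ⇒ a = 0`, a non-zero `f` is divisible
by `θ_c` for only finitely many `c`, a f.g. module killed by `f` and `θ_c` with `θ_c ∤ f` is finite; `…GenericSpecializationRankProofs`: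
a free submodule of full rank with torsion quotient):

* §1 **`eq_zero_of_forall_nsmul_mem_of_free`** — in a FREE `Λ`-module, an element `w` with `n_c • w ∈ θ_c • F` (`n_c ≥ 1`) for
  infinitely many `c ∈ 𝔪` is `0` (coordinates: `θ_c ∣ C(n_c)·w_i`, `θ_c` prime and `θ_c ∤ C(n_c)` ⇒ `θ_c ∣ w_i` for infinitely many `c`
  ⇒ `w_i = 0`).
* §2 **`mem_torsion_of_forall_nsmul_mem`** — in a FINITELY GENERATED `Λ`-module `T`, an element `u` with `n_c • u ∈ θ_c • T` (`n_c ≥ 1`)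
  for infinitely many `c ∈ 𝔪` lies in `T_{Λ-tors}` (pass to `T/T_tors`, torsion-free; a free `F ≤ T/T_tors` with torsion quotient and a
  regular `d` with `d·(T/T_tors) ⊆ F`; §1 for `d·ū`; `d·ū = 0 ⇒ ū = 0`). This is the honest content of «inertia acts trivially modulo
  torsion» for an endomorphism that is finite on infinitely many fibres (memo §3 step 2).
* §3 **`finite_torsionBy_quotient_of_le_torsion`** — `T` f.g., `J ≤ T_tors`, `c ∈ 𝔪`, `T[θ_c] = ⊥` ⇒ `(T ⧸ J)[θ_c]` is FINITE
  (`θ_c·t ∈ J ⊆ T_tors ⇒ t ∈ T_tors`; a regular annihilator `f₀ = θ_c^e·g`, `θ_c ∤ g`, of `T_tors` has `g·T_tors ⊆ T_tors[θ_c^e] = 0`;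
  so `(T/J)[θ_c]` is killed by `g` and `θ_c`, hence finite) (memo §3 step 4).

Use (file B of this seat, the arithmetic half): with `T = A₂^∨` (the Pontryagin dual of N1's branch-lattice module, f.g. by
`TelescopeK2FibreCofinite.isCofinitelyGenerated_of_fd`), §2 turns «`(ρ₂(τ) − 1)(A₂[X − x_k])` finite for infinitely many `k`» into
«`I_w` acts trivially on `f·A₂` for one `f ≠ 0`», and §3 turns that into the finiteness (fin_w) of `A₂^{I_w}/X·A₂^{I_w}` consumed by
p758349 `TelescopeK2WeightTwoControlMapOfFiniteDefect`. Nothing about any curve is asserted here.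

HONEST FRAMING: pure module theory over `ℤ_p⟦X⟧`; no registered stub, crux or summit statement is proved by this file; closes: none.

References: [GreenbergLNM1716] §4 p. 117 (generic `θ_s`; "`θ_s` irreducible and relatively prime"); [AgboolaHoward2006] Lemma 1.2.6
(arXiv:math/0302319 Lemma 2.2.6 p. 8); [Washington1997] §13.2 (structure of f.g. `Λ`-modules); [BourbakiAC5to7] VII §4.4.
-/

noncomputable section

-- D-0017: single-problem summit, the namespace repeats the problem name by design.
set_option linter.dupNamespace false
set_option autoImplicit false

open Literature.NumberTheory.EllipticCurves Literature.NumberTheory.EllipticCurves.IwasawaAlgebra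

namespace Summit.BirchSwinnertonDyer.BirchSwinnertonDyer.Theorems.TelescopeK2GenericFibreZero

variable {p : ℕ} [Fact p.Prime]

/-! ## §1 Free modules: coordinates divisible by infinitely many `θ_c` vanish -/

/-- `θ_c = X − C c` (`c ∈ 𝔪`) does not divide a non-zero natural constant `C n`. [cite: GreenbergLNM1716, §4 p. 115 (`ker σ_s = (θ_s)`)] -/
theorem not_X_sub_C_dvd_C_natCast {c : ℤ_[p]} (hc : c ∈ IsLocalRing.maximalIdeal ℤ_[p]) {n : ℕ} (hn : n ≠ 0) :
    ¬ ((PowerSeries.X - PowerSeries.C c : IwasawaAlgebra p) ∣ PowerSeries.C ((n : ℤ_[p]))) := fun h =>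
  hn (Nat.cast_eq_zero.1 (eq_zero_of_X_sub_C_dvd_C p hc h))

/-- If `θ_c ∣ C(n) * f` with `n ≠ 0` then `θ_c ∣ f` (`θ_c` prime, `θ_c ∤ C n`). [cite: GreenbergLNM1716, §4 p. 117 ("`θ_s` irreducible")] -/
theorem X_sub_C_dvd_of_dvd_natCast_mul {c : ℤ_[p]} (hc : c ∈ IsLocalRing.maximalIdeal ℤ_[p]) {n : ℕ} (hn : n ≠ 0)
    {f : IwasawaAlgebra p} (h : (PowerSeries.X - PowerSeries.C c : IwasawaAlgebra p) ∣ (n : IwasawaAlgebra p) * f) :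
    (PowerSeries.X - PowerSeries.C c : IwasawaAlgebra p) ∣ f := by
  rcases (prime_X_sub_C p hc).dvd_or_dvd h with h1 | h2
  · exact absurd (by rwa [← map_natCast (PowerSeries.C (R := ℤ_[p])) n] at h1) (not_X_sub_C_dvd_C_natCast hc hn)
  · exact h2

/-- A non-zero `f ∈ Λ` divisible by `θ_c` for every `c` in an INFINITE subset of `𝔪` does not exist: such an `f` is `0`.
[cite: GreenbergLNM1716, §4 p. 117] [cite: Washington1997, §7.1 (Weierstrass preparation: finitely many zeros)] -/
theorem eq_zero_of_forall_X_sub_C_dvd {S : Set ℤ_[p]} (hS : S.Infinite) (hS𝔪 : S ⊆ IsLocalRing.maximalIdeal ℤ_[p])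
    {f : IwasawaAlgebra p} (h : ∀ c ∈ S, (PowerSeries.X - PowerSeries.C c : IwasawaAlgebra p) ∣ f) : f = 0 := by
  by_contra hf
  exact hS ((finite_setOf_X_sub_C_dvd p hf).subset fun c hc => ⟨hS𝔪 hc, h c hc⟩)

/-- **§1, free modules.** In a free `Λ`-module `F`, an element `w` such that for every `c` in an infinite `S ⊆ 𝔪` some non-zero
multiple `n • w` lies in `θ_c • F` is zero. [cite: GreenbergLNM1716, §4 p. 117] [cite: AgboolaHoward2006, Lemma 1.2.6 (proof)] -/
theorem eq_zero_of_forall_nsmul_mem_of_free {F : Type*} [AddCommGroup F] [Module (IwasawaAlgebra p) F]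
    [Module.Free (IwasawaAlgebra p) F] {S : Set ℤ_[p]} (hS : S.Infinite) (hS𝔪 : S ⊆ IsLocalRing.maximalIdeal ℤ_[p])
    (w : F) (h : ∀ c ∈ S, ∃ n : ℕ, n ≠ 0 ∧ ∃ v : F, (n : IwasawaAlgebra p) • w = (PowerSeries.X - PowerSeries.C c) • v) :
    w = 0 := by
  classical
  let b := Module.Free.chooseBasis (IwasawaAlgebra p) F
  refine b.ext_elem fun i => ?_
  rw [map_zero, Finsupp.zero_apply]
  refine eq_zero_of_forall_X_sub_C_dvd hS hS𝔪 fun c hc => ?_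
  obtain ⟨n, hn, v, hv⟩ := h c hc
  refine X_sub_C_dvd_of_dvd_natCast_mul (hS𝔪 hc) hn ⟨b.repr v i, ?_⟩
  have := congrArg (fun x => b.repr x i) hv
  simpa only [map_smul, Finsupp.smul_apply, smul_eq_mul] using this

/-! ## §2 Finitely generated modules: such an element is torsion -/

/-- **§2.** In a finitely generated `Λ`-module `T`, an element `u` such that for every `c` in an infinite `S ⊆ 𝔪` some non-zero
multiple `n • u` lies in `θ_c • T` is a TORSION element. [cite: GreenbergLNM1716, §4 p. 117]
[cite: AgboolaHoward2006, Lemma 1.2.6 (arXiv:math/0302319 Lemma 2.2.6 p. 8)] [cite: Washington1997, §13.2] -/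
theorem mem_torsion_of_forall_nsmul_mem {T : Type*} [AddCommGroup T] [Module (IwasawaAlgebra p) T]
    [Module.Finite (IwasawaAlgebra p) T] {S : Set ℤ_[p]} (hS : S.Infinite) (hS𝔪 : S ⊆ IsLocalRing.maximalIdeal ℤ_[p])
    (u : T) (h : ∀ c ∈ S, ∃ n : ℕ, n ≠ 0 ∧ ∃ v : T, (n : IwasawaAlgebra p) • u = (PowerSeries.X - PowerSeries.C c) • v) :
    u ∈ Submodule.torsion (IwasawaAlgebra p) T := by
  classical
  -- pass to the torsion-free quotient `Q = T/T_tors`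
  set Q := T ⧸ Submodule.torsion (IwasawaAlgebra p) T with hQ
  let π : T →ₗ[IwasawaAlgebra p] Q := (Submodule.torsion (IwasawaAlgebra p) T).mkQ
  haveI : Module.Finite (IwasawaAlgebra p) Q := inferInstance
  haveI : Module.IsTorsionFree (IwasawaAlgebra p) Q := Submodule.QuotientTorsion.instIsTorsionFree
  -- a free `F ≤ Q` with torsion quotient, and a regular `d` pushing `Q` into `F`
  obtain ⟨F, hFfree, hFfin, -, hQF⟩ := exists_free_submodule_finrank_eq_isTorsion_quotient p (M := Q)
  haveI := hFfree
  obtain ⟨d, hdann, hd0⟩ := Submodule.annihilator_top_inter_nonZeroDivisors (R := IwasawaAlgebra p) (M := Q ⧸ F) hQF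
  have hdF : ∀ q : Q, d • q ∈ F := fun q => by
    have h1 : d • (F.mkQ q) = 0 := Submodule.mem_annihilator.1 hdann _ Submodule.mem_top
    rw [← map_smul, Submodule.mkQ_apply, Submodule.Quotient.mk_eq_zero] at h1
    exact h1
  -- `w := d • ū ∈ F` satisfies the hypothesis of §1 inside `F`
  set w : F := ⟨d • π u, hdF (π u)⟩ with hw
  have hw0 : w = 0 := by
    refine eq_zero_of_forall_nsmul_mem_of_free hS hS𝔪 w fun c hc => ?_
    obtain ⟨n, hn, v, hv⟩ := h c hc
    refine ⟨n, hn, ⟨d • π v, hdF (π v)⟩, Subtype.ext ?_⟩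
    change (n : IwasawaAlgebra p) • (d • π u) = (PowerSeries.X - PowerSeries.C c) • (d • π v)
    rw [smul_comm, ← map_smul, hv, map_smul, smul_comm]
  -- `d • ū = 0` with `d` regular ⇒ `ū = 0` ⇒ `u ∈ T_tors`
  have hdu : d • π u = 0 := congrArg Subtype.val hw0
  have hreg : IsSMulRegular Q d :=
    Module.IsTorsionFree.isSMulRegular (isRegular_iff_mem_nonZeroDivisors.2 hd0)
  have hu : π u = 0 := hreg (show d • π u = d • (0 : Q) by rw [hdu, smul_zero])
  rwa [Submodule.mkQ_apply, Submodule.Quotient.mk_eq_zero] at hu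

/-- **§2, annihilator form**: under the hypothesis of `mem_torsion_of_forall_nsmul_mem` for EVERY element of a submodule `N ≤ T`, one
regular `f ∈ Λ` kills `N` (a regular annihilator of the f.g. torsion module `T_tors`). [cite: Washington1997, §13.2]
[cite: GreenbergLNM1716, §4 p. 117] -/
theorem exists_mem_nonZeroDivisors_smul_eq_zero_of_forall {T : Type*} [AddCommGroup T] [Module (IwasawaAlgebra p) T]
    [Module.Finite (IwasawaAlgebra p) T] {S : Set ℤ_[p]} (hS : S.Infinite) (hS𝔪 : S ⊆ IsLocalRing.maximalIdeal ℤ_[p])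
    (N : Submodule (IwasawaAlgebra p) T)
    (h : ∀ u ∈ N, ∀ c ∈ S, ∃ n : ℕ, n ≠ 0 ∧ ∃ v : T, (n : IwasawaAlgebra p) • u = (PowerSeries.X - PowerSeries.C c) • v) :
    ∃ f : IwasawaAlgebra p, f ∈ nonZeroDivisors (IwasawaAlgebra p) ∧ ∀ u ∈ N, f • u = 0 := by
  haveI : IsNoetherian (IwasawaAlgebra p) T := isNoetherian_of_isNoetherianRing_of_finite _ _
  haveI : Module.Finite (IwasawaAlgebra p) (Submodule.torsion (IwasawaAlgebra p) T) :=
    Module.IsNoetherian.finite _ _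
  obtain ⟨f, hfann, hf0⟩ := Submodule.annihilator_top_inter_nonZeroDivisors (R := IwasawaAlgebra p)
    (M := Submodule.torsion (IwasawaAlgebra p) T) (Submodule.torsion_isTorsion)
  refine ⟨f, hf0, fun u hu => ?_⟩
  have hut : u ∈ Submodule.torsion (IwasawaAlgebra p) T := mem_torsion_of_forall_nsmul_mem hS hS𝔪 u (h u hu)
  have := Submodule.mem_annihilator.1 hfann ⟨u, hut⟩ Submodule.mem_top
  exact congrArg Subtype.val this

/-! ## §3 `(T/J)[θ]` is finite for `J ⊆ T_tors` when `T[θ] = 0` -/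

/-- If `T[θ] = ⊥` then `T[θ^e] = ⊥`. [folklore] -/
theorem torsionBy_pow_eq_bot {R : Type*} [CommRing R] {T : Type*} [AddCommGroup T] [Module R T] {θ : R}
    (h : Submodule.torsionBy R T θ = ⊥) (e : ℕ) : Submodule.torsionBy R T (θ ^ e) = ⊥ := by
  induction e with
  | zero => rw [pow_zero]; exact Submodule.torsionBy_one
  | succ e ih =>
    rw [eq_bot_iff]
    intro t ht
    rw [Submodule.mem_torsionBy_iff, pow_succ, mul_smul] at ht
    have h1 : θ • t ∈ Submodule.torsionBy R T (θ ^ e) := (Submodule.mem_torsionBy_iff _ _).2 ht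
    rw [ih, Submodule.mem_bot] at h1
    have h2 : t ∈ Submodule.torsionBy R T θ := (Submodule.mem_torsionBy_iff _ _).2 h1
    rwa [h] at h2

/-- If `θ • t` is torsion and `θ` is regular then `t` is torsion. [folklore] -/
theorem mem_torsion_of_smul_mem_torsion {R : Type*} [CommRing R] {T : Type*} [AddCommGroup T] [Module R T] {θ : R}
    (hθ : θ ∈ nonZeroDivisors R) {t : T} (h : θ • t ∈ Submodule.torsion R T) : t ∈ Submodule.torsion R T := by
  obtain ⟨⟨a, ha⟩, hat⟩ := (Submodule.mem_torsion_iff _).1 h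
  refine (Submodule.mem_torsion_iff _).2 ⟨⟨a * θ, mul_mem ha hθ⟩, ?_⟩
  change (a * θ) • t = 0
  rw [mul_smul]
  exact hat

/-- **§3.** `T` finitely generated over `Λ`, `J ≤ T_{Λ-tors}`, `c ∈ 𝔪_{ℤ_p}` with `T[θ_c] = ⊥`: then `(T ⧸ J)[θ_c]` is FINITE.
[cite: Washington1997, §13.2] [cite: GreenbergLNM1716, §4 p. 117 (choose `s` with `θ_s ∤ f(T)`)] -/
theorem finite_torsionBy_quotient_of_le_torsion {T : Type*} [AddCommGroup T] [Module (IwasawaAlgebra p) T]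
    [Module.Finite (IwasawaAlgebra p) T] (J : Submodule (IwasawaAlgebra p) T) (hJ : J ≤ Submodule.torsion (IwasawaAlgebra p) T)
    {c : ℤ_[p]} (hc : c ∈ IsLocalRing.maximalIdeal ℤ_[p])
    (hT : Submodule.torsionBy (IwasawaAlgebra p) T (PowerSeries.X - PowerSeries.C c : IwasawaAlgebra p) = ⊥) :
    Finite (Submodule.torsionBy (IwasawaAlgebra p) (T ⧸ J) (PowerSeries.X - PowerSeries.C c : IwasawaAlgebra p)) := by
  classical
  set θ : IwasawaAlgebra p := PowerSeries.X - PowerSeries.C c with hθdef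
  haveI : IsNoetherian (IwasawaAlgebra p) T := isNoetherian_of_isNoetherianRing_of_finite _ _
  haveI : Module.Finite (IwasawaAlgebra p) (Submodule.torsion (IwasawaAlgebra p) T) := Module.IsNoetherian.finite _ _
  -- a regular annihilator of `T_tors`, split as `θ^e * g` with `θ ∤ g`
  obtain ⟨f₀, hf₀ann, hf₀0⟩ := Submodule.annihilator_top_inter_nonZeroDivisors (R := IwasawaAlgebra p)
    (M := Submodule.torsion (IwasawaAlgebra p) T) (Submodule.torsion_isTorsion)
  have hf₀ne : f₀ ≠ 0 := nonZeroDivisors.ne_zero hf₀0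
  obtain ⟨e, g, hg, hf₀eq⟩ := WfDvdMonoid.max_power_factor hf₀ne (prime_X_sub_C p hc).irreducible
  -- `g` kills `T_tors`: `θ^e • (g • t) = f₀ • t = 0` and `T[θ^e] = ⊥`
  have hgT : ∀ t ∈ Submodule.torsion (IwasawaAlgebra p) T, g • t = 0 := by
    intro t ht
    have h1 : f₀ • t = 0 := by
      have := Submodule.mem_annihilator.1 hf₀ann ⟨t, ht⟩ Submodule.mem_top
      exact congrArg Subtype.val this
    have h2 : g • t ∈ Submodule.torsionBy (IwasawaAlgebra p) T (θ ^ e) := by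
      rw [Submodule.mem_torsionBy_iff, ← mul_smul, ← hf₀eq, h1]
    rw [torsionBy_pow_eq_bot hT e, Submodule.mem_bot] at h2
    exact h2
  -- `θ` is regular (non-zero in a domain)
  have hθreg : θ ∈ nonZeroDivisors (IwasawaAlgebra p) := mem_nonZeroDivisors_of_ne_zero (X_sub_C_ne_zero p c)
  -- the θ-torsion of `T/J` is killed by `g` and by `θ`
  let N := Submodule.torsionBy (IwasawaAlgebra p) (T ⧸ J) θ
  haveI : Module.Finite (IwasawaAlgebra p) N := Module.IsNoetherian.finite _ _
  refine finite_of_smul_eq_zero_of_not_X_sub_C_dvd p (M := N) hc hg (fun x => ?_) (fun x => ?_)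
  · -- `g • x = 0`: lift `x = [t]`, `θ • t ∈ J ⊆ T_tors ⇒ t ∈ T_tors ⇒ g • t = 0`
    obtain ⟨x, hx⟩ := x
    obtain ⟨t, rfl⟩ := Submodule.Quotient.mk_surjective J x
    apply Subtype.ext
    change g • Submodule.Quotient.mk t = (0 : T ⧸ J)
    have hθt : θ • t ∈ J := by
      rw [Submodule.mem_torsionBy_iff, ← Submodule.Quotient.mk_smul, Submodule.Quotient.mk_eq_zero] at hx
      exact hx
    have ht : t ∈ Submodule.torsion (IwasawaAlgebra p) T := mem_torsion_of_smul_mem_torsion hθreg (hJ hθt)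
    rw [← Submodule.Quotient.mk_smul, hgT t ht, Submodule.Quotient.mk_zero]
  · exact Subtype.ext ((Submodule.mem_torsionBy_iff _ _).1 x.2)

end Summit.BirchSwinnertonDyer.BirchSwinnertonDyer.Theorems.TelescopeK2GenericFibreZero

end
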